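import Summits.Ventures.PercRepro.MSRMStarAssembly
import Summits.Ventures.PercRepro.MSTightCompletionCoords
import Summits.Ventures.PercRepro.MSTightExcessOneExtension

/-!
# The mixed class of Conjecture V (complex trace, Case II): the tight-completion obstruction, and
monotonicity

The open piece of Conjecture V on residue instances is the candidate Prop `CaseIOfComplex α`
(`MSRMStarAssembly.lean`): at a tight-trace element `r ∈ u` with `{r} ∈ F`, Case I `u ∖ r ∈ F`
holds. Its negation is the **mixed class**: `{r} ∈ F`, `u₀ = u ∖ r ∉ P` (neither half contains
it) and `ū = S' ∖ u₀` `r`-lifted but not a member (`ū ∪ r ∈ F`, `ū ∉ F`). In it every member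
avoiding `r` is A-signable (`ū ∖ s ⊆ ū` is a face) and `{r}` is A-only, so the residue data reduce
to the signs (†) `∀ t ∈ F₁, t ∩ u₀ ∈ Y ∨ u₀ ∖ t ∈ P` and the C*-only member (‡) `∃ t₁ ∈ F₁,
t₁ ∩ u₀ ∉ Y` (dossier Addendum 62; census: empty at excess one on ≤ 5 points).

**The core lemma** (`not_tight_completion0_of_sides`). If the completion `F₀ ∪ (P + r)` of a
twin-free family with empty core is TIGHT, then by Theorem S in the coordinates of
MSTightCompletionCoords `P = L ⊻ U`, `F₀ = L ⊻ U₀` with `M = R* ∖ r`, and `U₀` an up-set within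
`M` containing `M`; a non-face `u₀` whose complement `ū` is a face but not a member, together
with the signs (†) on `F₁` (and at most one partnerless face), is impossible: `ū ∖ M ∈ L`,
`ū ∩ M ∉ U₀`, and the sign at a face `t` with `t ∩ u₀ = M ∩ u₀` and `u₀ ∖ t = u₀ ∖ M ∉ P`
produces a member avoiding `M ∩ u₀`, whose `M`-part lies inside `ū ∩ M`, so `ū ∩ M ∈ U₀`.

**The mixed class is monotone** (`MixedII.monotone`): by Theorem (MA) the labelling is monotone,
or `r` is addable, or a unique partnerless member completes; in the last two cases a tight
one-point extension with every face lifted exists (`tight_insert_of_partner_cover` at a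
`(K, P₁)`-cover, resp. `F ∪ {x ∪ r}`), and the core lemma applies — unless the cover's top is
`ū` itself, when `F ∪ {ū}` is tight against (‡) (`diffs_insert_eq_of_tight_insert`).
-/

namespace PercRepro.MSTight

open Finset
open scoped FinsetFamily

variable {α : Type*} [DecidableEq α] [Fintype α]

section Core

variable {r : α} {F : Finset (Finset α)}

omit [Fintype α] in
/-- A face of the trace is a difference of the completion (when `{r} ∈ F`). -/
theorem mem_diffs_completion0_of_mem_proj (hr : ({r} : Finset α) ∈ F) {e : Finset α}
    (he : e ∈ proj r F) : e ∈ completion0 r F \\ completion0 r F := by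
  have h1 := insert_mem_completion0_of_mem_proj (r := r) he
  have h0 : (∅ : Finset α) ∈ proj r F := mem_proj.2 ⟨{r}, hr, erase_singleton r⟩
  have h2 := insert_mem_completion0_of_mem_proj (r := r) h0
  have hre : r ∉ e := r_notMem_of_mem_proj he
  have := Finset.sdiff_mem_diffs h1 h2
  rwa [insert_empty, insert_sdiff_of_mem _ (mem_singleton_self r), sdiff_singleton_eq_erase,
    erase_eq_of_notMem hre] at this

/-- `M = cM r F` is a face of the trace (it is the member `∅ ∪ M` avoiding `r`). -/
theorem cM_mem_proj (htw : ∀ a b, Twin F a b → a = b) (hcore : ∀ a, ∃ t ∈ F, a ∉ t)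
    (hC : Tight (completion0 r F)) : cM r F ∈ proj r F := by
  have := union_mem_part0 htw hcore hC (empty_mem_cL hcore) (cM_mem_cU0 hcore)
  rw [empty_union] at this
  exact RMStar.mem_proj_of_mem_part0 this

/-- The `M`-part of a face is in `U`: `u₀ ∩ M ∈ U` whenever `M ∖ u₀ ⊆ ū` is a face. -/
theorem inter_cM_mem_cU_of_compl_subset (hP : Tight (proj r F)) (hr : ({r} : Finset α) ∈ F)
    (hsing : ∀ a, a ≠ r → ({a} : Finset α) ∈ proj r F) {u₀ : Finset α}
    (hubar : ubar r u₀ ∈ proj r F) : u₀ ∩ cM r F ∈ cU r F := by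
  refine mem_cU.2 ⟨inter_subset_right, ?_⟩
  have hsub : cM r F \ (u₀ ∩ cM r F) ⊆ ubar r u₀ := by
    intro a ha
    rw [mem_sdiff, mem_inter, not_and] at ha
    exact mem_ubar.2 ⟨fun h => r_notMem_cM (h ▸ ha.1), fun h => ha.2 h ha.1⟩
  exact mem_diffs_completion0_of_mem_proj hr (mem_proj_of_subset hP hr hsing hubar hsub)

/-- `u₀ ∖ M` is not a face when `u₀` is not (and `ū` is). -/
theorem sdiff_cM_notMem_proj (htw : ∀ a b, Twin F a b → a = b) (hcore : ∀ a, ∃ t ∈ F, a ∉ t)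
    (hC : Tight (completion0 r F)) (hP : Tight (proj r F)) (hr : ({r} : Finset α) ∈ F)
    (hsing : ∀ a, a ≠ r → ({a} : Finset α) ∈ proj r F) {u₀ : Finset α} (hru : r ∉ u₀)
    (hu0 : u₀ ∉ proj r F) (hubar : ubar r u₀ ∈ proj r F) : u₀ \ cM r F ∉ proj r F := by
  intro hmem
  apply hu0
  refine (mem_proj_iff_coords htw hcore hC hru).2 ⟨?_, inter_cM_mem_cU_of_compl_subset hP hr hsing hubar⟩
  have := sdiff_cM_mem_cL_of_mem_proj htw hcore hC hmem
  rwa [Finset.sdiff_idem] at this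

/-- **The core lemma.** A tight completion `F₀ ∪ (P + r)` is incompatible with a non-face `u₀`
whose complement `ū` is a face but not a member, once the signs (†) hold on the `r`-lifted faces
and at most one face is partnerless. -/
theorem not_tight_completion0_of_sides (htw : ∀ a b, Twin F a b → a = b)
    (hcore : ∀ a, ∃ t ∈ F, a ∉ t) (hC : Tight (completion0 r F)) (hP : Tight (proj r F))
    (hr : ({r} : Finset α) ∈ F) (hsing : ∀ a, a ≠ r → ({a} : Finset α) ∈ proj r F)
    {u₀ : Finset α} (hru : r ∉ u₀) (hu0 : u₀ ∉ proj r F) (hubar : ubar r u₀ ∈ proj r F)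
    (hubar0 : ubar r u₀ ∉ part0 r F) (hubne : (ubar r u₀).Nonempty)
    (hone : ∀ e ∈ proj r F, e ∉ partr r F → ∀ e' ∈ proj r F, e' ∉ partr r F → e = e')
    (hsign : ∀ t ∈ partr r F, t ∩ u₀ ∈ diffsY r F ∨ u₀ \ t ∈ proj r F) : False := by
  have hrM : r ∉ cM r F := r_notMem_cM
  have hrub : r ∉ ubar r u₀ := notMem_ubar_self r u₀
  have hMP : cM r F ∈ proj r F := cM_mem_proj htw hcore hC
  -- the coordinates of `ū`
  have hubL : ubar r u₀ \ cM r F ∈ cL r F := sdiff_cM_mem_cL_of_mem_proj htw hcore hC hubar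
  have hubU0 : ubar r u₀ ∩ cM r F ∉ cU0 r F := fun h =>
    hubar0 ((mem_part0_iff_coords htw hcore hC hrub).2 ⟨hubL, h⟩)
  have hu0M : u₀ \ cM r F ∉ proj r F := sdiff_cM_notMem_proj htw hcore hC hP hr hsing hru hu0 hubar
  -- a member `s` avoiding `r` and `M ∩ u₀` gives the contradiction
  have key : ∀ s ∈ part0 r F, Disjoint (cM r F ∩ u₀) s → False := by
    intro s hs hd
    apply hubU0
    have h1 : s ∩ cM r F ∈ cU0 r F := inter_cM_mem_cU0_of_mem_part0 htw hcore hC hs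
    refine isUpSetWithin_cU0 htw hcore hC _ h1 _ inter_subset_right ?_
    intro a ha
    rw [mem_inter] at ha ⊢
    refine ⟨mem_ubar.2 ⟨fun h => hrM (h ▸ ha.2), fun h => ?_⟩, ha.2⟩
    exact Finset.disjoint_left.1 hd (mem_inter.2 ⟨ha.2, h⟩) ha.1
  -- a sign at a face `t ∈ F₁` with `t ∩ u₀ = M ∩ u₀` and `u₀ ∖ t = u₀ ∖ M`
  have useSign : ∀ t ∈ partr r F, t ∩ u₀ = cM r F ∩ u₀ → u₀ \ t = u₀ \ cM r F → False := by
    intro t ht h1 h2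
    rcases hsign t ht with hY | hPf
    · rw [h1] at hY
      obtain ⟨a, _, s, hs, has⟩ := Finset.mem_diffs.1 hY
      exact key s hs (by rw [← has]; exact sdiff_disjoint)
    · rw [h2] at hPf
      exact hu0M hPf
  -- the candidate faces
  have hMu0P : cM r F ∩ u₀ ∈ proj r F := mem_proj_of_subset hP hr hsing hMP inter_subset_left
  by_cases hMu1 : cM r F ∩ u₀ ∈ partr r F
  · exact useSign _ hMu1 (by rw [inter_assoc, inter_self]) (by
      ext a; simp only [mem_sdiff, mem_inter, not_and]; tauto)
  · -- `M ∩ u₀` is the unique partnerless face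
    by_cases hex : ∃ m ∈ cM r F, m ∉ u₀
    · obtain ⟨m, hmM, hmu⟩ := hex
      have htP : insert m (cM r F ∩ u₀) ∈ proj r F :=
        mem_proj_of_subset hP hr hsing hMP (insert_subset hmM inter_subset_left)
      have hne : insert m (cM r F ∩ u₀) ≠ cM r F ∩ u₀ := fun h =>
        hmu (mem_inter.1 (h ▸ mem_insert_self m _)).2
      have ht1 : insert m (cM r F ∩ u₀) ∈ partr r F := by
        by_contra h
        exact hne (hone _ htP h _ hMu0P hMu1)
      refine useSign _ ht1 ?_ ?_
      · ext a
        simp only [mem_inter, mem_insert]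
        constructor
        · rintro ⟨(rfl | ⟨h1, _⟩), h2⟩
          · exact absurd h2 hmu
          · exact ⟨h1, h2⟩
        · rintro ⟨h1, h2⟩
          exact ⟨Or.inr ⟨h1, h2⟩, h2⟩
      · ext a
        simp only [mem_sdiff, mem_insert, mem_inter, not_or, not_and]
        constructor
        · rintro ⟨h1, h2, h3⟩
          exact ⟨h1, fun h => h3 h h1⟩
        · rintro ⟨h1, h2⟩
          exact ⟨h1, fun h => hmu (h ▸ h1), fun h _ => h2 h⟩
    · -- `M ⊆ u₀`: use the face `ū ∪ M`
      have hMsub : cM r F ⊆ u₀ := fun m hm => by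
        by_contra h
        exact hex ⟨m, hm, h⟩
      have htP : ubar r u₀ ∪ cM r F ∈ proj r F := by
        refine (mem_proj_iff_coords htw hcore hC ?_).2 ⟨?_, ?_⟩
        · rw [mem_union, not_or]
          exact ⟨hrub, hrM⟩
        · have : (ubar r u₀ ∪ cM r F) \ cM r F = ubar r u₀ \ cM r F := by
            rw [union_sdiff_right]
          rw [this]
          exact hubL
        · have : (ubar r u₀ ∪ cM r F) ∩ cM r F = cM r F := by
            rw [union_inter_cancel_right]
          rw [this]
          exact cU0_subset_cU htw hcore hC (cM_mem_cU0 hcore)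
      have hne : ubar r u₀ ∪ cM r F ≠ cM r F ∩ u₀ := by
        intro h
        obtain ⟨a, ha⟩ := hubne
        have : a ∈ cM r F ∩ u₀ := h ▸ mem_union_left _ ha
        exact (mem_ubar.1 ha).2 (mem_inter.1 this).2
      have ht1 : ubar r u₀ ∪ cM r F ∈ partr r F := by
        by_contra h
        exact hne (hone _ htP h _ hMu0P hMu1)
      refine useSign _ ht1 ?_ ?_
      · ext a
        simp only [mem_inter, mem_union]
        constructor
        · rintro ⟨(h1 | h1), h2⟩
          · exact absurd h2 (mem_ubar.1 h1).2
          · exact ⟨h1, h2⟩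
        · rintro ⟨h1, h2⟩
          exact ⟨Or.inr h1, h2⟩
      · ext a
        simp only [mem_sdiff, mem_union, not_or]
        constructor
        · rintro ⟨h1, _, h3⟩
          exact ⟨h1, h3⟩
        · rintro ⟨h1, h2⟩
          exact ⟨h1, fun h => (mem_ubar.1 h).2 h1, h2⟩

end Core

section Mixed

variable {r : α} {F : Finset (Finset α)}

omit [Fintype α] in
/-- The projection, the `r`-lifted faces and the members avoiding `r` of `F ∪ {A}` for an `A`
avoiding `r` that is already a face. -/
theorem proj_insert_eq_of_mem {A : Finset α} (hrA : r ∉ A) (hA : A ∈ proj r F) :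
    proj r (insert A F) = proj r F ∧ partr r (insert A F) = partr r F ∧
      part0 r (insert A F) = insert A (part0 r F) := by
  refine ⟨?_, ?_, ?_⟩
  · rw [proj, image_insert, erase_eq_of_notMem hrA, ← proj, insert_eq_of_mem hA]
  · ext t
    simp only [mem_partr, mem_insert]
    constructor
    · rintro ⟨hrt, (h | h)⟩
      · exact absurd (h ▸ mem_insert_self r t) hrA
      · exact ⟨hrt, h⟩
    · rintro ⟨hrt, h⟩
      exact ⟨hrt, Or.inr h⟩
  · ext t
    simp only [mem_part0, mem_insert]
    constructor
    · rintro ⟨(rfl | h), hrt⟩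
      · exact Or.inl rfl
      · exact Or.inr ⟨h, hrt⟩
    · rintro (rfl | ⟨h, hrt⟩)
      · exact ⟨Or.inl rfl, hrA⟩
      · exact ⟨Or.inr h, hrt⟩

omit [Fintype α] in
/-- When every face is `r`-lifted, the completion is `F` itself. -/
theorem completion0_eq_self_of_forall (h : ∀ p ∈ proj r F, p ∈ partr r F) :
    completion0 r F = F := by
  ext A
  rw [mem_completion0]
  constructor
  · rintro (hA | ⟨p, hp, rfl⟩)
    · exact (mem_part0.1 hA).1
    · exact (mem_partr.1 (h p hp)).2
  · intro hA
    by_cases hrA : r ∈ A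
    · exact Or.inr ⟨A.erase r, mem_proj.2 ⟨A, hA, rfl⟩, insert_erase hrA⟩
    · exact Or.inl (mem_part0.2 ⟨hA, hrA⟩)

omit [Fintype α] in
/-- When `x` is the only face that is not `r`-lifted, the completion is `F ∪ {insert r x}`. -/
theorem completion0_eq_insert_of_unique {x : Finset α} (hx : x ∈ proj r F)
    (h : ∀ p ∈ proj r F, p ∉ partr r F → p = x) : completion0 r F = insert (insert r x) F := by
  ext A
  rw [mem_completion0, mem_insert]
  constructor
  · rintro (hA | ⟨p, hp, rfl⟩)
    · exact Or.inr (mem_part0.1 hA).1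
    · by_cases hp1 : p ∈ partr r F
      · exact Or.inr (mem_partr.1 hp1).2
      · exact Or.inl (by rw [h p hp hp1])
  · rintro (rfl | hA)
    · exact Or.inr ⟨x, hx, rfl⟩
    · by_cases hrA : r ∈ A
      · exact Or.inr ⟨A.erase r, mem_proj.2 ⟨A, hA, rfl⟩, insert_erase hrA⟩
      · exact Or.inl (mem_part0.2 ⟨hA, hrA⟩)

/-- **The mixed class at `r`** (the negation of `CaseIOfComplex`, reduced to its trace data):
excess one, `{r} ∈ F`, `∅ ∉ F`, twin-free with empty core, a tight trace with all singletons,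
`u₀ ∌ r` not a face, `ū = ubar r u₀` `r`-lifted, not a member and nonempty, the signs (†) on the
`r`-lifted faces, a C*-only member (‡), and validity. -/
structure MixedII (r : α) (F : Finset (Finset α)) (u₀ : Finset α) : Prop where
  exc : (F \\ F).card = F.card + 1
  tightP : Tight (proj r F)
  singleton_mem : ({r} : Finset α) ∈ F
  empty_notMem : (∅ : Finset α) ∉ F
  twinFree : ∀ a b, Twin F a b → a = b
  core : ∀ a, ∃ t ∈ F, a ∉ t
  sing : ∀ a, a ≠ r → ({a} : Finset α) ∈ proj r F
  r_notMem : r ∉ u₀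
  u0_notMem_proj : u₀ ∉ proj r F
  ubar_mem_partr : ubar r u₀ ∈ partr r F
  ubar_notMem_part0 : ubar r u₀ ∉ part0 r F
  ubar_nonempty : (ubar r u₀).Nonempty
  signs : ∀ t ∈ partr r F, t ∩ u₀ ∈ diffsY r F ∨ u₀ \ t ∈ proj r F
  cstar_only : ∃ t ∈ partr r F, t ∩ u₀ ∉ diffsY r F
  valid : ∀ t ∈ partr r F, ∀ s ∈ part0 r F, Disjoint t s → t ∪ s = Finset.univ.erase r → False

namespace MixedII

variable {u₀ : Finset α}

/-- `ū` is a face. -/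
theorem ubar_mem_proj (h : MixedII r F u₀) : ubar r u₀ ∈ proj r F :=
  RMStar.mem_proj_of_mem_partr h.ubar_mem_partr

/-- `ū` is not a member. -/
theorem ubar_notMem (h : MixedII r F u₀) : ubar r u₀ ∉ F := fun hm =>
  h.ubar_notMem_part0 (mem_part0.2 ⟨hm, notMem_ubar_self r u₀⟩)

/-- **(‡) as a non-tightness.** `F ∪ {ū}` is not tight: a tight one-point extension keeps the
difference family, and `(t₁ ∪ r) ∖ ū = (t₁ ∩ u₀) ∪ r` would make `t₁ ∩ u₀` a type-I difference. -/
theorem not_tight_insert_ubar (h : MixedII r F u₀) : ¬ Tight (insert (ubar r u₀) F) := by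
  intro hT
  obtain ⟨t, ht, htY⟩ := h.cstar_only
  have hD := diffs_insert_eq_of_tight_insert h.exc h.ubar_notMem hT
  have hrt : r ∉ t := (mem_partr.1 ht).1
  have hmem : insert r t \ ubar r u₀ ∈ insert (ubar r u₀) F \\ insert (ubar r u₀) F :=
    Finset.sdiff_mem_diffs (mem_insert_of_mem (mem_partr.1 ht).2) (mem_insert_self _ _)
  rw [hD] at hmem
  have heq : insert r t \ ubar r u₀ = insert r (t ∩ u₀) := by
    ext a
    simp only [mem_sdiff, mem_insert, mem_inter, mem_ubar, not_and, not_not]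
    constructor
    · rintro ⟨(rfl | ha), h2⟩
      · exact Or.inl rfl
      · exact Or.inr ⟨ha, h2 (fun h' => hrt (h' ▸ ha))⟩
    · rintro (rfl | ⟨ha, hau⟩)
      · exact ⟨Or.inl rfl, fun h' => absurd rfl h'⟩
      · exact ⟨Or.inr ha, fun _ => hau⟩
  rw [heq] at hmem
  have h2 : insert r (t ∩ u₀) ∈ (F \\ F).filter (fun E => r ∈ E) :=
    mem_filter.2 ⟨hmem, mem_insert_self r _⟩
  rw [diffs_filter_mem] at h2
  obtain ⟨y, hy, hy'⟩ := mem_image.1 h2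
  have hry : r ∉ y := notMem_of_mem_diffsY hy
  have hry' : r ∉ t ∩ u₀ := fun h' => hrt (mem_inter.1 h').1
  have : y = t ∩ u₀ := by rw [← erase_insert hry, hy', erase_insert hry']
  exact htY (this ▸ hy)

/-- **The mixed class is monotone**: `F₁` is a down-set and `F₀` an up-set of the trace. -/
theorem monotone (h : MixedII r F u₀) :
    (∀ t ∈ partr r F, ∀ e ∈ proj r F, e ⊆ t → e ∈ partr r F) ∧
      (∀ s ∈ part0 r F, ∀ e ∈ proj r F, s ⊆ e → e ∈ part0 r F) := by
  rcases monotone_or_completed h.exc h.tightP h.singleton_mem h.empty_notMem h.sing with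
    hm | hadd | ⟨x, hx0, hx1, hT, hxu, _⟩
  · exact hm
  · -- `r` addable: every face is `r`-lifted; a failure of the up-set gives a tight extension
    have hall : ∀ p ∈ proj r F, p ∈ partr r F := fun p hp =>
      (RMStar.part0_or_partr hp).elim (fun h0 => hadd p h0) id
    refine ⟨fun t _ e he _ => hall e he, ?_⟩
    intro s hs e he hse
    by_contra he0
    obtain ⟨s', hs', b, hb, hbs'P, hbs'0⟩ := exists_cover_of_not_upSet h.tightP h.singleton_mem
      h.sing he he0 hs hse
    have hbs'1 : insert b s' ∈ partr r F := hall _ hbs'P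
    have hG : Tight (insert (insert b s') F) :=
      tight_insert_of_partner_cover h.exc h.tightP h.singleton_mem h.empty_notMem h.sing hs'
        hbs'1 hbs'0
    have hrA : r ∉ insert b s' := (mem_partr.1 hbs'1).1
    obtain ⟨hproj, hpartr, hpart0⟩ := proj_insert_eq_of_mem (F := F) hrA hbs'P
    -- the cover's top is not `ū`
    have hne : insert b s' ≠ ubar r u₀ := fun heq => h.not_tight_insert_ubar (heq ▸ hG)
    -- the core lemma for `G = F ∪ {insert b s'}`
    refine not_tight_completion0_of_sides (F := insert (insert b s') F)
      (fun a c hac => h.twinFree a c (fun t ht => hac t (mem_insert_of_mem ht)))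
      (fun a => (h.core a).imp fun t ht => ⟨mem_insert_of_mem ht.1, ht.2⟩)
      ?_ (by rw [hproj]; exact h.tightP) (mem_insert_of_mem h.singleton_mem)
      (by rw [hproj]; exact h.sing) h.r_notMem (by rw [hproj]; exact h.u0_notMem_proj)
      (by rw [hproj]; exact h.ubar_mem_proj) ?_ h.ubar_nonempty ?_ ?_
    · rw [completion0_eq_self_of_forall]
      · exact hG
      · intro p hp
        rw [hproj] at hp
        rw [hpartr]
        exact hall p hp
    · rw [hpart0, mem_insert, not_or]
      exact ⟨fun heq => hne heq.symm, h.ubar_notMem_part0⟩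
    · intro e he he1
      rw [hproj] at he
      rw [hpartr] at he1
      exact absurd (hall e he) he1
    · intro t ht
      rw [hpartr] at ht
      rw [hproj]
      rcases h.signs t ht with hY | hPf
      · left
        obtain ⟨a, ha, s, hsF, has⟩ := Finset.mem_diffs.1 hY
        rw [diffsY, hpartr, hpart0]
        exact Finset.mem_diffs.2 ⟨a, ha, s, mem_insert_of_mem hsF, has⟩
      · exact Or.inr hPf
  · -- a unique completing partnerless member: the completion `F ∪ {insert r x}` is tight
    exfalso
    have hxP : x ∈ proj r F := RMStar.mem_proj_of_mem_part0 hx0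
    have hone' : ∀ p ∈ proj r F, p ∉ partr r F → p = x := fun p hp hp1 =>
      hxu p ((RMStar.part0_or_partr hp).resolve_right hp1) hp1
    refine not_tight_completion0_of_sides h.twinFree h.core ?_ h.tightP h.singleton_mem h.sing
      h.r_notMem h.u0_notMem_proj h.ubar_mem_proj h.ubar_notMem_part0 h.ubar_nonempty ?_ h.signs
    · rw [completion0_eq_insert_of_unique hxP hone']
      exact hT
    · intro e he he1 e' he' he'1
      rw [hone' e he he1, hone' e' he' he'1]

end MixedII

end Mixed

end PercRepro.MSTight
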